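import Literature.AnabelianGeometry.SemiGraphs.WitnessIwahoriBundle
import Literature.AnabelianGeometry.SemiGraphs.TemperedCoveringsSubgraph
import HarnessLib

/-!
# A concrete semi-graph of anabelioids WITH A CUSP: one vertex `P = ℤ_p ⋊ (1 + pℤ_p)`, one OPEN edge
# `U = 1 + pℤ_p` glued along the torus (witness; all clauses of [SemiAnbd] Prop. 3.6 / Thm. 3.7)

Witness file of the abc-iut cell (block F, seat abc-iut-f-177; companion of `WitnessIwahoriLoop` /
`WitnessIwahoriApprox` / `WitnessIwahoriBundle`, abc-iut-L3 row WIT-1b, whose group theory it reuses BY NAME).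
Source of the hypotheses: S. Mochizuki, *Semi-graphs of anabelioids*, Publ. RIMS **42** (2006), §1 p. 11–13
(semi-graphs, open edges, "the sub-semi-graph obtained by omitting all of the open edges"), Def. 2.1 p. 22
(injective type), Def. 2.3 pp. 24–25 (approximators, quasi-coherent), Def. 2.4 pp. 25–26 (elevated,
verticially slim, aloof, estranged), Prop. 3.6 p. 38 / Thm. 3.7 p. 40 (the hypothesis bundles), with the
Galois-countability erratum [IUTchI] Rmk. 2.5.3 (i) (T2) as bundled in the tree's `Prop36Hypotheses` /
`Thm37Hypotheses`.

THE OBJECT `cuspGraph p` (local presentation `ProfiniteSemiGraph`, universe `0`): underlying semi-graph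
`cuspSemiGraph` = ONE vertex `v`, ONE edge `e` whose branch `true` abuts to `v` and whose branch `false`
abuts to NO vertex — so `e` is an open edge of verticial cardinality `1`, a CUSP (`cuspSemiGraph_vertCard`);
vertex group `Π_v := P = ℤ_p ⋊ (1 + pℤ_p)` (`Iw p`), edge group `Π_e := U = 1 + pℤ_p` (`IwU p`), the abutting
branch mapping `U` onto the torus `T_0 = {(0, s)}` (`Iw.bHom 0`).

KERNEL-CHECKED CLAUSES: connected, countable, has a vertex, of injective type, verticially slim (`P` slim,
`isSlimGroup_Iw`), totally aloof and totally ESTRANGED (malnormality of the torus,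
`Iw.range_bHom_inf_conj_eq_bot_of_not_mem`; `T_0` infinite), quasi-coherent and totally elevated (the
level-`n` approximators `(P_n, U_n, s ↦ (0, s))` of `WitnessIwahoriApprox`, here `cuspApprox`),
Galois-countable (trivialising coverings of the approximators, `Approximator.trivCov`); assembled:
`cuspGraph_prop36Hypotheses`, `cuspGraph_thm37Hypotheses`.  Also: the sub-semi-graph `cuspOmission p`
(every vertex, no edge) IS A CUSP OMISSION (`cuspOmission_isCuspOmission`), so the tree's
`TemperedCuspOmission` applies: `B^temp(cuspGraph p) ≌ B^temp` of the one-vertex edgeless restriction, with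
the SAME tempered fundamental group.

Purpose: the carrier of the kernel counter-model for FACT-LIST row F-1727 (`SpecialFibreIsoOfChartIso`,
[SemiAnbd] Cor. 3.11 proof step (S3)) in `TemperedSpecialFibreReductionsSchemaS3.lean`: two semi-graphs of
anabelioids with equivalent `B^temp` but non-isomorphic underlying semi-graphs.  A witness certifies
consistency / non-vacuity only; it is not the special fibre of any curve; no statement of the paper is
touched; no instance, no notation, no `Prop` fact is declared.  Nothing here bears on [IUTchIII] Cor. 3.12.
[cite: MochizukiSemiAnbd2006, Def 2.4 p.25-26]
-/

noncomputable section

open Topology CategoryTheory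

namespace Literature.AnabelianGeometry.SemiGraphs

open Literature.AlgebraicGeometry.Frobenioids (IsSlimGroup)

namespace IwahoriWitness

open ProfiniteSemiGraph

variable (p : ℕ) [Fact p.Prime]

/-! ## 1. The object -/

/-- The semi-graph with one vertex and one OPEN edge: the branch `true` of the edge abuts to the vertex,
the branch `false` abuts to no vertex ([SemiAnbd] §1 p. 11: "`ζ_e(b) = 𝒱`", an edge of verticial
cardinality `1`). [cite: MochizukiSemiAnbd2006, §1 p.11] -/
def cuspSemiGraph : SemiGraph.{0} where
  Vertex := PUnit
  Edge := PUnit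
  Branch := Bool
  edgeOf _ := PUnit.unit
  abuts b := cond b (some PUnit.unit) none
  two_branches _ := ⟨true, false, Bool.noConfusion, rfl, rfl, fun b _ => by cases b <;> simp⟩

/-- The abutting branch. [cite: MochizukiSemiAnbd2006, §1 p.11] -/
@[simp] theorem cuspSemiGraph_abuts_true : cuspSemiGraph.abuts true = some PUnit.unit := rfl

/-- The non-abutting branch. [cite: MochizukiSemiAnbd2006, §1 p.11] -/
@[simp] theorem cuspSemiGraph_abuts_false : cuspSemiGraph.abuts false = none := rfl

/-- A branch abutting to a vertex is the branch `true`. [cite: MochizukiSemiAnbd2006, §1 p.11] -/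
theorem cuspSemiGraph_eq_true_of_abuts {b : cuspSemiGraph.Branch} {v : cuspSemiGraph.Vertex}
    (h : cuspSemiGraph.abuts b = some v) : b = true := by
  cases b
  · cases h
  · rfl

/-- The verticial portion of the edge is `{true}`. [cite: MochizukiSemiAnbd2006, §1 p.11] -/
theorem cuspSemiGraph_verticialPortion (e : cuspSemiGraph.Edge) :
    cuspSemiGraph.verticialPortion e = {true} := by
  ext b
  cases b
  · exact ⟨fun h => (Bool.false_ne_true h.2).elim,
      fun h => (Bool.false_ne_true (Set.mem_singleton_iff.mp h)).elim⟩
  · exact ⟨fun _ => Set.mem_singleton _, fun _ => ⟨rfl, rfl⟩⟩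

/-- **The edge is a cusp**: its verticial cardinality is `1` (an open, non-isolated edge).
[cite: MochizukiSemiAnbd2006, §1 p.12] -/
theorem cuspSemiGraph_vertCard (e : cuspSemiGraph.Edge) : cuspSemiGraph.vertCard e = 1 := by
  unfold SemiGraph.vertCard
  rw [cuspSemiGraph_verticialPortion]
  simp

/-- The edge is open. [cite: MochizukiSemiAnbd2006, §1 p.12] -/
theorem cuspSemiGraph_isOpenEdge (e : cuspSemiGraph.Edge) : cuspSemiGraph.IsOpenEdge e := by
  unfold SemiGraph.IsOpenEdge
  rw [cuspSemiGraph_vertCard]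
  exact Nat.one_lt_two

/-- **The witness `cuspGraph p`**: the cusp semi-graph with vertex group `P = ℤ_p ⋊ (1 + pℤ_p)`, edge group
`U = 1 + pℤ_p`, the (abutting) branch mapping `U` onto the torus `T_0 = {(0, s)}` (`Iw.bHom 0`).
[cite: MochizukiSemiAnbd2006, Def 2.1 p.22] -/
def cuspGraph : ProfiniteSemiGraph.{0} where
  graph := cuspSemiGraph
  Gv _ := Iw p
  Ge _ := IwU p
  brHom _ _ _ := Iw.bHom 0

/-- The branch maps of `cuspGraph p` are the torus embedding `b_0`. [cite: MochizukiSemiAnbd2006, Def 2.1 p.22] -/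
@[simp] theorem cuspGraph_brHom (b : cuspSemiGraph.Branch) (v : cuspSemiGraph.Vertex)
    (h : cuspSemiGraph.abuts b = some v) : (cuspGraph p).brHom b v h = Iw.bHom 0 := rfl

/-- The branch subgroups of `cuspGraph p` are the torus `T_0`. [cite: MochizukiSemiAnbd2006, §2 p.23] -/
theorem cuspGraph_branchSubgroup (b : cuspSemiGraph.Branch) (v : cuspSemiGraph.Vertex)
    (h : cuspSemiGraph.abuts b = some v) :
    (cuspGraph p).branchSubgroup b v h = (Iw.bHom (p := p) 0).toMonoidHom.range := rfl

/-! ## 2. The combinatorial clauses -/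

/-- `cuspGraph p` has a vertex. [cite: MochizukiSemiAnbd2006, Thm 3.7 p.40] -/
theorem cuspGraph_hasVertex : (cuspGraph p).HasVertex := ⟨PUnit.unit⟩

/-- `cuspGraph p` is countable (finite). [cite: MochizukiSemiAnbd2006, §1 p.11] -/
theorem cuspGraph_isCountable : (cuspGraph p).IsCountable :=
  ⟨inferInstanceAs (Countable PUnit), inferInstanceAs (Countable PUnit)⟩

/-- The cusp semi-graph is connected: in its barycentric subdivision the vertex is joined to the branch
`true`, which is joined to the edge-point, which is joined to the branch `false`.
[cite: MochizukiSemiAnbd2006, §1 p.11] -/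
theorem cuspSemiGraph_isConnected : cuspSemiGraph.IsConnected := by
  classical
  set G := cuspSemiGraph
  have htv : G.subdivision.Reachable (Sum.inr (Sum.inr true)) (Sum.inl PUnit.unit) :=
    (SemiGraph.subdivision_adj_of_nodeRel G (SemiGraph.NodeRel.branch_vertex true PUnit.unit rfl)).reachable
  have heb : ∀ b : G.Branch, G.subdivision.Reachable (Sum.inr (Sum.inl PUnit.unit)) (Sum.inr (Sum.inr b)) :=
    fun b => (SemiGraph.subdivision_adj_of_nodeRel G (SemiGraph.NodeRel.edge_branch b)).reachable
  have hall : ∀ a : G.Node, G.subdivision.Reachable a (Sum.inl PUnit.unit) := by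
    intro a
    rcases a with ⟨⟨⟩⟩ | ⟨⟨⟩⟩ | b
    · exact SimpleGraph.Reachable.refl _
    · exact (heb true).trans htv
    · exact ((heb b).symm.trans (heb true)).trans htv
  haveI : Nonempty G.Node := ⟨Sum.inl PUnit.unit⟩
  exact ⟨⟨fun a b => (hall a).trans (hall b).symm⟩⟩

/-- `cuspGraph p` is connected. [cite: MochizukiSemiAnbd2006, §1 p.11] -/
theorem cuspGraph_isConnected : (cuspGraph p).IsConnected := cuspSemiGraph_isConnected

/-! ## 3. Injective type, verticial slimness, estrangement -/

/-- `cuspGraph p` is of injective type: the torus embedding is injective.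
[cite: MochizukiSemiAnbd2006, Def 2.1 p.22] -/
theorem cuspGraph_isOfInjectiveType : (cuspGraph p).IsOfInjectiveType :=
  fun _ _ _ => Iw.bHom_injective 0

/-- `cuspGraph p` is verticially slim (`P` is slim). [cite: MochizukiSemiAnbd2006, Def 2.4(ii) p.25] -/
theorem cuspGraph_isVerticiallySlim : (cuspGraph p).IsVerticiallySlim := fun _ => isSlimGroup_Iw p

/-- The core intersection computation: for abutting branches `b, b'` of `cuspGraph p` (both are the branch
`true`) and `g ∈ P` with `b' ≠ b` or `g ∉ Π_b = T_0`, `Π_b ∩ g Π_{b'} g⁻¹ = 1` — malnormality of the torus.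
[cite: MochizukiSemiAnbd2006, Def 2.4(iv) p.26] -/
theorem cuspGraph_branch_inf_conj_eq_bot {b b' : cuspSemiGraph.Branch} {v : cuspSemiGraph.Vertex}
    (h : cuspSemiGraph.abuts b = some v) (h' : cuspSemiGraph.abuts b' = some v) (g : Iw p)
    (hg : b' ≠ b ∨ g ∉ (Iw.bHom (p := p) 0).toMonoidHom.range) :
    (Iw.bHom (p := p) 0).toMonoidHom.range ⊓
        ((Iw.bHom (p := p) 0).toMonoidHom.range.map (MulAut.conj g).toMonoidHom) = ⊥ := by
  obtain rfl := cuspSemiGraph_eq_true_of_abuts h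
  obtain rfl := cuspSemiGraph_eq_true_of_abuts h'
  exact Iw.range_bHom_inf_conj_eq_bot_of_not_mem _ (hg.resolve_left fun hne => hne rfl)

/-- The edge of `cuspGraph p` is aloof: the intersections above have infinite index (relative index `0`)
in `Π_b ≅ ℤ_p`. [cite: MochizukiSemiAnbd2006, Def 2.4(iv) p.26] -/
theorem cuspGraph_isTotallyAloof : (cuspGraph p).IsTotallyAloof := by
  intro e b _ v h b' h' g hg
  rw [cuspGraph_branchSubgroup] at hg ⊢
  rw [cuspGraph_branchSubgroup]
  exact Iw.relIndex_eq_zero_of_inf_eq_bot _ (cuspGraph_branch_inf_conj_eq_bot p h h' g hg)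

/-- **The edge of `cuspGraph p` is estranged** (Def. 2.4 (iv)): aloof, and the intersections are trivial.
[cite: MochizukiSemiAnbd2006, Def 2.4(iv) p.26] -/
theorem cuspGraph_isTotallyEstranged : (cuspGraph p).IsTotallyEstranged := by
  intro e
  refine ⟨cuspGraph_isTotallyAloof p e, ?_⟩
  intro b _ v h b' h' g hg
  rw [cuspGraph_branchSubgroup] at hg ⊢
  rw [cuspGraph_branchSubgroup]
  exact cuspGraph_branch_inf_conj_eq_bot p h h' g hg

/-! ## 4. Approximators: quasi-coherence and total elevation -/

/-- **The level-`n` approximator of `cuspGraph p`** (Def. 2.3 (i)(ii)): finite groups `P_n`, `U_n`, the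
reductions, the branch map `s ↦ (0, s)` mod `pⁿ` (injective), compatible with `b_0` on the nose (`g = 1`),
of bounded order `|P_n|`. [cite: MochizukiSemiAnbd2006, Def 2.3(i) p.24] -/
def cuspApprox (n : ℕ) : (cuspGraph p).Approximator where
  FV _ := IwMod p n
  FE _ := IwUMod p n
  πV _ := Iw.toMod n
  πE _ := IwU.toMod n
  isOpen_ker_πV _ := Iw.isOpen_ker_toMod n
  isOpen_ker_πE _ := IwU.isOpen_ker_toMod n
  brF _ _ _ := IwMod.brMod 0
  brF_injective _ _ _ := IwMod.brMod_injective _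
  comm b v h := ⟨1, fun x => by
    rw [one_mul, inv_one, mul_one]
    ext
    · show (0 : ZMod (p ^ n)) * PadicInt.toZModPow n x.s = PadicInt.toZModPow n (0 * x.s)
      rw [zero_mul, zero_mul, map_zero]
    · rfl⟩
  bounded := ⟨Nat.card (IwMod p n), Nat.card_pos, fun _ => dvd_rfl⟩

/-- The approximators are `π₁`-epimorphic. [cite: MochizukiSemiAnbd2006, Def 2.3(ii) p.25] -/
theorem cuspApprox_isPiOneEpimorphic (n : ℕ) : (cuspApprox p n).IsPiOneEpimorphic :=
  ⟨fun _ => Iw.toMod_surjective n, fun _ => IwU.toMod_surjective n⟩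

/-- **`cuspGraph p` is quasi-coherent** (Def. 2.3 (iii)): given finite coverings of the two constituents,
the level-`n` approximator for `n` large splits both. [cite: MochizukiSemiAnbd2006, Def 2.3(iii) p.25] -/
theorem cuspGraph_isQuasiCoherent : (cuspGraph p).IsQuasiCoherent := by
  intro M HV HE hV hE
  haveI : Finite (HV PUnit.unit).obj.V := (hV PUnit.unit).2
  haveI : Finite (HE PUnit.unit).obj.V := (hE PUnit.unit).2
  obtain ⟨n₁, hn₁⟩ := exists_level_acts_trivially_V p (HV PUnit.unit)
  obtain ⟨n₂, hn₂⟩ := exists_level_acts_trivially_E p (HE PUnit.unit)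
  refine ⟨cuspApprox p (max n₁ n₂), ?_, ?_⟩
  · rintro ⟨⟩ g hg x
    exact hn₁ g (Iw.toMod_eq_one_mono (le_max_left _ _) g hg) x
  · rintro ⟨⟩ g hg x
    exact hn₂ g (IwU.toMod_eq_one_mono (le_max_right _ _) g hg) x

/-- **`cuspGraph p` is totally elevated** (Def. 2.4 (i)): at level `M` the translation subgroup of `P_M`
has order `p^M ≥ M` and meets no conjugate of the branch image. [cite: MochizukiSemiAnbd2006, Def 2.4(i) p.25] -/
theorem cuspGraph_isTotallyElevated : (cuspGraph p).IsTotallyElevated := by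
  intro v M
  refine ⟨cuspApprox p M, cuspApprox_isPiOneEpimorphic p M, IwMod.transl, ?_, ?_⟩
  · exact (Nat.lt_pow_self (Fact.out : p.Prime).one_lt).le.trans (IwMod.card_transl (p := p) (n := M)).ge
  · intro b h g
    exact IwMod.transl_inf_conj_range_brMod _ g

/-! ## 5. Galois-countability -/

/-- The trivialising covering of the level-`n` approximator: a finite object of `B^cov(cuspGraph p)` with
nonempty fibres. [cite: MochizukiSemiAnbd2006, Prop 2.5 p.27] -/
def cuspLevelCov (n : ℕ) : CovObj (cuspGraph p) :=
  (cuspApprox p n).trivCov (M := Nat.card (IwMod p n)) Nat.card_pos fun _ => dvd_rfl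

/-- A point of the `v`-constituent of `cuspLevelCov n` fixed by `g` forces `g` into the level-`n` kernel.
[cite: MochizukiSemiAnbd2006, Prop 2.5 p.27] -/
theorem toMod_eq_one_of_fix_cuspLevelCov_V (n : ℕ) (v : (cuspGraph p).graph.Vertex)
    (x : ((cuspLevelCov p n).SV v).obj.V) (g : Iw p) (h : ((cuspLevelCov p n).SV v).obj.ρ g x = x) :
    Iw.toMod n g = 1 := by
  have h' : ((cuspApprox p n).objV (Nat.card (IwMod p n)) v).obj.ρ g x = x := h
  rw [Approximator.objV_ρ] at h'
  exact mul_eq_right.1 (Prod.ext_iff.1 h').1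

/-- Same over the edge. [cite: MochizukiSemiAnbd2006, Prop 2.5 p.27] -/
theorem toMod_eq_one_of_fix_cuspLevelCov_E (n : ℕ) (e : (cuspGraph p).graph.Edge)
    (x : ((cuspLevelCov p n).SE e).obj.V) (g : IwU p) (h : ((cuspLevelCov p n).SE e).obj.ρ g x = x) :
    IwU.toMod n g = 1 := by
  have h' : ((cuspApprox p n).objE (Nat.card (IwMod p n)) e).obj.ρ g x = x := h
  rw [Approximator.objE_ρ] at h'
  exact mul_eq_right.1 (Prod.ext_iff.1 h').1

/-- **`cuspGraph p` is Galois-countable** ([IUTchI] Rmk. 2.5.3 (i) (T2)): the trivialising coverings of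
the level approximators split every finite covering. [cite: Mochizuki2012, IUTchI Rmk 2.5.3 (i) (T2), p. 52] -/
theorem cuspGraph_isGaloisCountable : (cuspGraph p).IsGaloisCountable := by
  refine ⟨cuspGraph_isCountable p, cuspLevelCov p, fun n => ⟨?_, ?_⟩, ?_⟩
  · exact (cuspApprox p n).trivCov_isFinite _ _
  · exact (cuspApprox p n).trivCov_hasNonemptyFibres _ _
  · intro H hH
    haveI : Finite (H.SV PUnit.unit).obj.V := hH.finite_V PUnit.unit
    haveI : Finite (H.SE PUnit.unit).obj.V := hH.finite_E PUnit.unit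
    obtain ⟨n₁, h₁⟩ := exists_level_acts_trivially_V p (H.SV PUnit.unit)
    obtain ⟨n₂, h₂⟩ := exists_level_acts_trivially_E p (H.SE PUnit.unit)
    refine ⟨max n₁ n₂, ?_, ?_⟩
    · rintro ⟨⟩ x g hgx s
      exact h₁ g (Iw.toMod_eq_one_mono (le_max_left _ _) g
        (toMod_eq_one_of_fix_cuspLevelCov_V p _ _ x g hgx)) s
    · rintro ⟨⟩ x g hgx s
      exact h₂ g (IwU.toMod_eq_one_mono (le_max_right _ _) g
        (toMod_eq_one_of_fix_cuspLevelCov_E p _ _ x g hgx)) s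

/-! ## 6. The bundles -/

/-- **`cuspGraph p` satisfies the hypotheses of Prop. 3.6** — with a cusp present.
[cite: MochizukiSemiAnbd2006, Prop 3.6 p.38] -/
theorem cuspGraph_prop36Hypotheses : (cuspGraph p).Prop36Hypotheses where
  isConnected := cuspGraph_isConnected p
  isCountable := cuspGraph_isCountable p
  isGaloisCountable := cuspGraph_isGaloisCountable p
  hasVertex := cuspGraph_hasVertex p
  isOfInjectiveType := cuspGraph_isOfInjectiveType p
  isQuasiCoherent := cuspGraph_isQuasiCoherent p
  isTotallyElevated := cuspGraph_isTotallyElevated p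
  isTotallyAloof := cuspGraph_isTotallyAloof p
  isVerticiallySlim := cuspGraph_isVerticiallySlim p

/-- **`cuspGraph p` satisfies the hypotheses of Thm. 3.7** (totally estranged).
[cite: MochizukiSemiAnbd2006, Thm 3.7 p.40] -/
theorem cuspGraph_thm37Hypotheses : (cuspGraph p).Thm37Hypotheses where
  toProp36Hypotheses := cuspGraph_prop36Hypotheses p
  isTotallyEstranged := cuspGraph_isTotallyEstranged p

/-- Non-vacuity WITH A CUSP: some semi-graph of anabelioids with an open edge satisfies the hypotheses of
Thm. 3.7. [cite: MochizukiSemiAnbd2006, Thm 3.7 p.40] -/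
theorem exists_thm37Hypotheses_with_cusp :
    ∃ 𝒢 : ProfiniteSemiGraph.{0}, (∃ e : 𝒢.graph.Edge, 𝒢.graph.IsOpenEdge e) ∧ 𝒢.Thm37Hypotheses :=
  ⟨cuspGraph 2, ⟨PUnit.unit, cuspSemiGraph_isOpenEdge _⟩, cuspGraph_thm37Hypotheses 2⟩

/-! ## 7. Omitting the cusp -/

/-- The sub-semi-graph of `cuspGraph p` with every vertex and no edge ("the sub-semi-graph obtained by
omitting all of the open edges", [SemiAnbd] §1 p. 13). [cite: MochizukiSemiAnbd2006, §1 p.13] -/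
def cuspOmission : (cuspGraph p).graph.Subgraph := ⟨Set.univ, ∅⟩

/-- The vertices of `cuspOmission p`: all of them. [cite: MochizukiSemiAnbd2006, §1 p.13] -/
@[simp] theorem cuspOmission_verts : (cuspOmission p).verts = Set.univ := rfl

/-- The edges of `cuspOmission p`: none. [cite: MochizukiSemiAnbd2006, §1 p.13] -/
@[simp] theorem cuspOmission_edges : (cuspOmission p).edges = ∅ := rfl

/-- **`cuspOmission p` is a cusp omission**: every vertex is kept and the omitted edge has exactly one
abutting branch. [cite: MochizukiSemiAnbd2006, §1 p.13] -/
theorem cuspOmission_isCuspOmission : (cuspOmission p).IsCuspOmission where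
  verts_eq := rfl
  existsUnique_abuts _ _ := ⟨true, rfl, rfl, fun b' _ hb' => by
    cases b'
    · cases hb'
    · rfl⟩

/-- The restriction of `cuspGraph p` along `cuspOmission p` has no edges.
[cite: MochizukiSemiAnbd2006, §1 p.13] -/
theorem isEmpty_edge_restrict_cuspOmission :
    IsEmpty ((cuspGraph p).restrict (cuspOmission p)).graph.Edge :=
  ⟨fun e => e.2⟩

/-- The restriction of `cuspGraph p` along `cuspOmission p` has exactly one vertex.
[cite: MochizukiSemiAnbd2006, §1 p.13] -/
theorem nonempty_unique_vertex_restrict_cuspOmission :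
    Nonempty (Unique ((cuspGraph p).restrict (cuspOmission p)).graph.Vertex) :=
  ⟨{ default := ⟨PUnit.unit, trivial⟩, uniq := fun _ => rfl }⟩

/-- There is NO morphism of semi-graphs from the cusp semi-graph to its cusp-omitted restriction (the
edge has nowhere to go) — in particular the two are not isomorphic, although (tree,
`TemperedCuspOmission`) their `B^temp`'s are equivalent. [cite: MochizukiSemiAnbd2006, §1 p.13] -/
theorem isEmpty_hom_restrict_cuspOmission :
    IsEmpty (SemiGraph.Hom (cuspGraph p).graph ((cuspGraph p).restrict (cuspOmission p)).graph) :=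
  ⟨fun F => (F.edgeMap PUnit.unit).2⟩

end IwahoriWitness

end Literature.AnabelianGeometry.SemiGraphs

end
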